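import Mathlib
import HarnessLib
import Literature.MathematicalPhysics.StatisticalMechanics.AbkmPackageShrink

/-!
# [ABKM19] — the `q`-regularity and state slots of Lemma 12.6 / Theorem 6.8 bundled on the SHRUNK state ball
# (`N`-free sizes; named `Prop`s only)

[ABKM19] (Adams–Buchholz–Kotecký–Müller, arXiv:1910.13564) Theorem 6.8 bounds the RG step operator `S_k^{(q)}`
and its state derivatives on a ball `B_ρ` of the state `(H, K)`; the mixed `q`/state slot `F4l'` and the state slot
`H1σ2` of `AbkmPackageSlots` are obtained in the tree by the HOLOMORPHIC route (Cauchy estimates along complex state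
lines), which needs a bidisc of positive radius around the state corners INSIDE the Theorem-6.8 ball of radius
`P.r`.  The honest form of those slots is therefore «Theorem 6.8 on the `P.r`-ball, corners in the `P.r/8`-ball»,
i.e. the slots of the SHRUNK package `P.shrink` (`AbkmPackageShrink`: the same package with `r ↦ r/8`; a
`PackageAt P.shrink N M` is the same data as a `PackageAt P N M`).  This file only NAMES the corresponding bundles,
with the sizes bound BEFORE `∀ N` (uniformity in the height `N` of the torus by quantifier order):

* `F4lPrimeShrink d` — an `N`-free size for the mixed slot `F4l'` of `P.shrink`, every package `P`;
* `H1bcStatementShrink d` — an `N`-free size for the state slot `H1σ2` of `P.shrink`, every package `P`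
  (the tree's `Summit.….Theorems.ComplexGFF.h1bcStatement_shrink` is exactly one instance `P` of it);
* `F4l2Shrink d` — an `N`-free size for the second `q`-difference slot `F4l2` of `P.shrink`, every package `P`
  (the weakest form the free-energy assembly consumes; the full-radius family implies it by `P ↦ P.shrink`);
* `F4StatementShrink d` — all nine `q`-slots `F4a … F4Φ22` of `P.shrink` with `N`-free sizes, every package `P`
  (= `F4Statement` with `P ↦ P.shrink` under the binders; binder order identical);
* (monotonicity in the typing, not restated as theorems here: each full-radius named fact of `AbkmPackageSlots`
  implies its shrunk form by instantiating the package at `P.shrink`, e.g. `fun P _ _ => h P.shrink`.)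

Use (honest scope): these are the re-typed by-name children of the cruxes `HypACumulant` / `HypALocalTwoPoint` of
the rung route `Summits/HubbardSuperconductivity/…/Theses/ComplexGFFStiffness` (rung H2gff / 1c: volume-uniform
stiffness of a complex Gaussian gradient field via the [ABKM19] renormalisation group).  Nothing about
superconductivity in the Hubbard model is claimed or advanced here.  Definitions only; NOTHING in this
file is asserted.

## References
* S. Adams, S. Buchholz, R. Kotecký, S. Müller, *Cauchy–Born rule from microscopic models with non-convex
  potentials*, arXiv:1910.13564 — Thm 6.8 (the ball `B_ρ`, smoothness of `S`), Lemma 8.4, Lemma 12.6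
  (12.51)–(12.53), Ch. 12 (12.4) [AdamsBuchholzKoteckyMuller2019].
* S. Buchholz, *Finite range decomposition for Gaussian measures with improved regularity*, J. Funct. Anal.
  275 (2018) 1674–1711, Thm 2.4 / Thm 4.5 [Buchholz2016].
-/

noncomputable section

namespace Literature.MathematicalPhysics.StatisticalMechanics.GradientRG

/-! ## The shrunk-ball bundles (sizes bound BEFORE `∀ N`) -/

/-- **`F4lPrimeShrink d`**: for every [ABKM19] package `P`, an `N`-FREE size `l_T' ≥ 0` of the mixed `q`/state slot
`F4l'` (the `q`-difference of `S_k` is Lipschitz in the state) for the SHRUNK package `P.shrink` (state corners in the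
`P.r/8`-ball, Theorem 6.8 available on the `P.r`-ball), at every height `N`.
[cite: AdamsBuchholzKoteckyMuller2019, Lemma 12.6 (12.53) / Thm 6.8] -/
def F4lPrimeShrink (d : ℕ) : Prop :=
  ∀ (P : PackageData d) [Fact (0 < P.h)] [Fact (0 < P.L)],
    ∃ lT' : ℝ, 0 ≤ lT' ∧ ∀ (N M : ℕ) [NeZero M] (Q : PackageAt P.shrink N M), F4l' P.shrink Q lT'

/-- **`H1bcStatementShrink d`**: for every [ABKM19] package `P`, an `N`-FREE joint state second-difference size
`σ₂ ≥ 0` of `(u, v) ↦ S_q(u, v)` (slot `H1σ2`) for the SHRUNK package `P.shrink`, at every height `N` — the form of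
`H1bcStatement` the holomorphic route delivers (Cauchy–Schwarz along complex state lines inside the Theorem-6.8 ball).
[cite: AdamsBuchholzKoteckyMuller2019, Thm 6.8 (smoothness of S) / Ch. 12 (12.4)] -/
def H1bcStatementShrink (d : ℕ) : Prop :=
  ∀ (P : PackageData d) [Fact (0 < P.h)] [Fact (0 < P.L)],
    ∃ σ₂ : ℝ, 0 ≤ σ₂ ∧ ∀ (N M : ℕ) [NeZero M] (Q : PackageAt P.shrink N M), H1σ2 P.shrink Q σ₂

/-- **`F4l2Shrink d`**: for every [ABKM19] package `P`, an `N`-FREE size `l_TT ≥ 0` of the mixed second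
`q`-differences of `q ↦ S_q(u, v)` (slot `F4l2`, `ℓ = 2` of (12.53)) for the SHRUNK package `P.shrink`, at every
height `N` (states in the `P.r/8`-ball; the weakest form the free-energy assembly consumes).
[cite: AdamsBuchholzKoteckyMuller2019, Lemma 8.4 / Lemma 12.6 (12.53)] -/
def F4l2Shrink (d : ℕ) : Prop :=
  ∀ (P : PackageData d) [Fact (0 < P.h)] [Fact (0 < P.L)],
    ∃ lTT : ℝ, 0 ≤ lTT ∧ ∀ (N M : ℕ) [NeZero M] (Q : PackageAt P.shrink N M), F4l2 P.shrink Q lTT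

/-- **`F4StatementShrink d`**: for every [ABKM19] package `P`, `N`-FREE sizes for all nine `q`-slots
`F4a F4b F4l F4a2 F4b2 F4l2 F4l' F4Φ2 F4Φ22` of the SHRUNK package `P.shrink`, at every height `N` — literally
`F4Statement` with the package instantiated at `P.shrink` (same binder and conjunct order).
[cite: AdamsBuchholzKoteckyMuller2019, Lemma 12.6 (12.51)–(12.53) / Lemma 8.4] -/
def F4StatementShrink (d : ℕ) : Prop :=
  ∀ (P : PackageData d) [Fact (0 < P.h)] [Fact (0 < P.L)],
    ∃ aT bT lT aTT bTT lTT lT' φT φTT : ℝ, 0 ≤ aT ∧ 0 ≤ bT ∧ 0 ≤ lT ∧ 0 ≤ aTT ∧ 0 ≤ bTT ∧ 0 ≤ lTT ∧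
      0 ≤ lT' ∧ 0 ≤ φT ∧ 0 ≤ φTT ∧
      ∀ (N M : ℕ) [NeZero M] (Q : PackageAt P.shrink N M),
        F4a P.shrink Q aT ∧ F4b P.shrink Q bT ∧ F4l P.shrink Q lT ∧ F4a2 P.shrink Q aTT ∧
          F4b2 P.shrink Q bTT ∧ F4l2 P.shrink Q lTT ∧ F4l' P.shrink Q lT' ∧ F4Φ2 P.shrink Q φT ∧
            F4Φ22 P.shrink Q φTT

end Literature.MathematicalPhysics.StatisticalMechanics.GradientRG

end
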